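/-
Copyright (c) 2026. All rights reserved.
Released under Apache 2.0 license as described in the file LICENSE.
Authors: abc-iut cell, wave-4 seat abc-iut-w4-d085 (L3 sub-DAG Thm 5.4, coordinator assembly of (iii)).
-/
import Literature.AnabelianGeometry.SemiGraphs.ArithMaximalCompactReductions
import Literature.AnabelianGeometry.SemiGraphs.ArithQuasiGeometricOpenness
import Literature.AnabelianGeometry.SemiGraphs.ArithmeticCoveringsInnerEquivProofs
import HarnessLib

/-!
# [SemiAnbd] Theorem 5.4 (iii): assembly of the typed correspondence statement from the sub-DAG rows
# T54-R (clause 1 via (ii)), T54-5 (openness transfer), T54-6 (clause 2) — modulo clause 3 (T54-7)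

Mochizuki, *Semi-graphs of anabelioids*, Publ. RIMS **42** (2006), §5, Theorem 5.4 (iii) p. 66
[cite: MochizukiSemiAnbd2006, Thm 5.4 (iii), p. 66]: "applying `B^temp(−)` determines a natural bijective
correspondence between locally open morphisms `𝔊 → ℍ` over `A` and arithmetically quasi-geometric morphisms
of temperoids `B^temp(𝔊) → B^temp(ℍ)` over `A^⊤`", typed by abc-iut-L3-t3 as
`ArithQuasiGeometricCorrespondenceStatement 𝔊 ℍ e augG augH btemp` (`ArithmeticCoverings.lean`), a predicate
on explicit data (the map "apply `B^temp`" `btemp` is a PARAMETER; no arithmetic `Π^temp_𝔊` is constructed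
in the tree).

PROOF-ONLY (no definition): the coordinator's assembly `arithQuasiGeometricCorrespondenceStatement_of_rows`
of sub-DAG #4 (HOME/plan/L3/SUBDAG-SemiAnbd-Thm54.md) — the typed statement from exactly these named inputs:
CLAUSE 1 per representative `φ` over `A`: Thm 5.4 (ii) on both sides (`ArithMaximalCompactStatementII`, rows
T54-3/T54-R/T54-4b), Rmk 5.3.1 on both sides (row T54-1), continuity of `btemp φ` and "over `A^⊤`", and the
per-vertex / per-branch containment-plus-GEOMETRIC-openness data of the induced homomorphism (the producer's
functoriality input, row T54-5's `(h2)`) — composed through abc-iut-w4-d106's openness transfer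
`hV_of_compat` / `hE_of_compat` (`ArithQuasiGeometricOpenness.lean`) and `isArithQuasiGeometric_of_statementII`
(`ArithMaximalCompactReductions.lean`); CLAUSE 2 from its exact residual `hinj` (abc-iut-w4-d082,
`ArithmeticCoveringsInnerEquivProofs.lean`, `innerEquiv_iff_exists_conj_of_injective`); CLAUSE 3 (surjectivity,
row T54-7) as the hypothesis `h3` verbatim. Nothing here asserts any input; nothing bears on [IUTchIII]
Cor. 3.12.
-/

namespace Literature.AnabelianGeometry.SemiGraphs

open _root_.CategoryTheory Literature.AlgebraicGeometry.Frobenioids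

universe u v w uG uH uV uB uV' uB'

variable {Obj : Type u} [Category.{v} Obj] {𝓥 : SemiAnbdVocab.{u, v, w} Obj}
variable {𝔊 ℍ : ArithSemiGraph 𝓥} {e : 𝔊.PA ≃* ℍ.PA}
variable {Gtp : Type uG} [Group Gtp] [TopologicalSpace Gtp]
variable {Htp : Type uH} [Group Htp] [TopologicalSpace Htp] [IsTopologicalGroup Htp] [T2Space Htp]
variable {V : Type uV} {B : Type uB} {V' : Type uV'} {B' : Type uB'}
variable {D : DecompositionData Gtp V B} {D' : DecompositionData Htp V' B'}

/-- **[SemiAnbd] Theorem 5.4 (iii) assembled from the sub-DAG rows** (`ArithQuasiGeometricCorrespondenceStatement`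
for the data `(𝔊, ℍ, e, augG, augH, btemp)` with decomposition data `D`, `D'` on the two arithmetic tempered
groups): clause 1 from Thm 5.4 (ii) + Rmk 5.3.1 on both sides and, for every locally open `φ` over `A`,
the continuity / over-`A^⊤` / containment-and-geometric-openness data of `B^temp(φ)`; clause 2 from the
injectivity residual `hinj`; clause 3 assumed (`h3`, row T54-7).
[cite: MochizukiSemiAnbd2006, Thm 5.4 (iii), p. 66] -/
theorem arithQuasiGeometricCorrespondenceStatement_of_rows (augG : Gtp →* 𝔊.PA) (augH : Htp →* ℍ.PA)
    (btemp : (φ : ArithHom 𝓥 𝔊 ℍ) → φ.IsLocallyOpen → ArithHom.IsOverA 𝔊 ℍ e φ → (Gtp →* Htp))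
    (hIIG : ArithMaximalCompactStatementII D augG)
    (hIIH : ArithMaximalCompactStatementII D' (e.symm.toMonoidHom.comp augH))
    (hRG : VerticialEdgeLikeCompactAmpleStatement D augG)
    (hRH : VerticialEdgeLikeCompactAmpleStatement D' (e.symm.toMonoidHom.comp augH))
    (haugH : Continuous (e.symm.toMonoidHom.comp augH))
    (hcont : ∀ (φ : ArithHom 𝓥 𝔊 ℍ) (h₁ : φ.IsLocallyOpen) (h₂ : ArithHom.IsOverA 𝔊 ℍ e φ),
      Continuous (btemp φ h₁ h₂))
    (hover : ∀ (φ : ArithHom 𝓥 𝔊 ℍ) (h₁ : φ.IsLocallyOpen) (h₂ : ArithHom.IsOverA 𝔊 ℍ e φ),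
      (e.symm.toMonoidHom.comp augH).comp (btemp φ h₁ h₂) = augG)
    (hv : ∀ (φ : ArithHom 𝓥 𝔊 ℍ) (h₁ : φ.IsLocallyOpen) (h₂ : ArithHom.IsOverA 𝔊 ℍ e φ),
      ∃ f : V → V', ∀ v : V, ∃ g : Htp,
        (D.vertGp v).map (btemp φ h₁ h₂) ≤ conjSubgroup g (D'.vertGp (f v)) ∧
          MapsOntoOpenSubgroupOf (btemp φ h₁ h₂) (D.vertGp v ⊓ augG.ker)
            (conjSubgroup g (D'.vertGp (f v)) ⊓ (e.symm.toMonoidHom.comp augH).ker))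
    (hb : ∀ (φ : ArithHom 𝓥 𝔊 ℍ) (h₁ : φ.IsLocallyOpen) (h₂ : ArithHom.IsOverA 𝔊 ℍ e φ),
      ∃ fb : B → B', ∀ b : B, ∃ g : Htp,
        (D.brGp b).map (btemp φ h₁ h₂) ≤ conjSubgroup g (D'.brGp (fb b)) ∧
          MapsOntoOpenSubgroupOf (btemp φ h₁ h₂) (D.brGp b ⊓ augG.ker)
            (conjSubgroup g (D'.brGp (fb b)) ⊓ (e.symm.toMonoidHom.comp augH).ker))
    (hinj : ∀ (φ ψ : ArithHom 𝓥 𝔊 ℍ) (h₁ : φ.IsLocallyOpen) (h₂ : ArithHom.IsOverA 𝔊 ℍ e φ)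
      (k₁ : ψ.IsLocallyOpen) (k₂ : ArithHom.IsOverA 𝔊 ℍ e ψ),
      (∃ h : Htp, ∀ g : Gtp, btemp ψ k₁ k₂ g = h * btemp φ h₁ h₂ g * h⁻¹) → φ = ψ)
    (h3 : ∀ f : Gtp →* Htp, IsArithQuasiGeometric augG (e.symm.toMonoidHom.comp augH) f →
      ∃ (φ : ArithHom 𝓥 𝔊 ℍ) (h₁ : φ.IsLocallyOpen) (h₂ : ArithHom.IsOverA 𝔊 ℍ e φ) (h : Htp),
        ∀ g, f g = h * btemp φ h₁ h₂ g * h⁻¹) :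
    Literature.AnabelianGeometry.SemiGraphs.ArithQuasiGeometricCorrespondenceStatement 𝔊 ℍ e augG augH btemp := by
  refine Thm54iii.arithQuasiGeometricCorrespondenceStatement_of_injective augG augH btemp ?_ hinj h3
  intro φ h₁ h₂
  obtain ⟨f, hf⟩ := hv φ h₁ h₂
  obtain ⟨fb, hfb⟩ := hb φ h₁ h₂
  exact isArithQuasiGeometric_of_statementII hIIG hIIH (hcont φ h₁ h₂) (hover φ h₁ h₂)
    (hV_of_compat haugH (hcont φ h₁ h₂) (hover φ h₁ h₂) hRG hRH f hf)
    (hE_of_compat haugH (hcont φ h₁ h₂) (hover φ h₁ h₂) hRG hRH fb hfb)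

end Literature.AnabelianGeometry.SemiGraphs
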